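import Mathlib
import HarnessLib
import Summits.Ventures.LatticeQCDFlow.Exactness.SphereFlowTransport

/-!
# The covariance law `(d/ds)⟨H∘Φ_{c−s}⟩_s = Cov_s(H∘Φ_{c−s}, 𝓛_sG − S)` for the law transported by the sphere gradient flow, and Lüscher's criterion: a flow action solving `𝓛_sG = S + C_s` on `[0, c]` transports `π̄` to `e^{−cS}π̄/Z_c`

HONEST FRAMING: exact (Metropolis-corrected) sampling algorithms for lattice gauge theory;
figures of merit are autocorrelation/cost numbers at stated couplings and volumes; no
continuum-physics claim.

Venture `LatticeQCDFlow` (cell pub-lqcd), topic `Exactness`; FANOUT row 7 (`s0-cpn-null`: the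
S0-D1 rung — 2D CP⁹, Lüscher's LO trivializing map inside HMC, Engel–Schaefer 2011).  NEW WORK of
the cell over the tree's `Exactness/SphereFlowTransport.lean` (this leg: the transport identity
`(d/ds)∫e^{−sS}(H∘Ψ_s)dπ̄ = ∫e^{−sS}(H∘Ψ_s)(𝓛_sG_s − S)dπ̄` for a pull-back family `Ψ_s`, e.g.
`Ψ_s = Φ_{c−s}`), `Exactness/SphereTiltedGreen.lean` (`∫e^{−tS}𝓛_tG dπ̄ = 0`),
`Exactness/SphereLuscherFiniteTimeUniqueness.lean` (`0 < ∫e^{−tS}dπ̄`),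
`Exactness/SphereLuscherNormalization.lean` (`integral_tilted_neg_action`) and Mathlib
(`HasDerivAt.div`, `constant_of_has_deriv_right_zero`, `Measure.tilted`); nothing is cited as a
fact.  Printed counterpart, NAMED ONLY: M. Lüscher, Commun. Math. Phys. 293 (2010) 899, §3
(3.4)–(3.9), §4.2 (4.5)–(4.9) (a generator solving `𝓛_tS̃_t = S + Ċ_t` makes the flow map
trivialize `e^{−tS}`; Lüscher argues through the Jacobian — here the observable is transported
instead, no Jacobians).

* §1 **`Z′(s) = −∫e^{−sS}S dπ̄`** (**`hasDerivAt_integral_exp_neg_mul`**: the transport identity with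
  `H ≡ 1` and the zero generator) and **THE COVARIANCE LAW**
  (**`hasDerivAt_tiltedMean_comp_family`**, **`hasDerivAt_tiltedMean_comp_sphereGradientFlow`**):
  for the tilted means `⟨·⟩_s = ∫e^{−sS}·dπ̄ / ∫e^{−sS}dπ̄`,
  `(d/ds)⟨H∘Φ_{c−s}⟩_s = ⟨(H∘Φ_{c−s})·R_s⟩_s − ⟨H∘Φ_{c−s}⟩_s·⟨R_s⟩_s`, `R_s = 𝓛_sG − S` — THE
  TRANSPORTED LAW DEPARTS FROM THE TILTED FAMILY AT THE RATE OF THE COVARIANCE BETWEEN THE OBSERVABLE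
  AND THE RESIDUAL OF LÜSCHER'S FLOW EQUATION (using `∫e^{−sS}R_s dπ̄ = −∫e^{−sS}S dπ̄ = Z′(s)`).
* §2 **LÜSCHER'S CRITERION ON THE LATTICE OF SITE SPHERES**
  (**`tiltedMean_comp_family_eq_of_residual_const`**, **`integral_comp_sphereGradientFlow_eq_tiltedMean`**,
  **`integral_comp_sphereGradientFlow_eq_integral_tilted`**): if the residual is CONSTANT on `Ω` for
  every `s ∈ [0, c]` — `G` solves `𝓛_sG = S + C_s` there — then for every `C¹` observable
  `∫ H(Φ_c ω) dπ̄(ω) = ∫ e^{−cS}H dπ̄ / ∫ e^{−cS} dπ̄ = ∫ H d(π̄.tilted(−cS))`: THE FLOW MAP `Φ_c`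
  PUSHES THE A-PRIORI MEASURE FORWARD TO THE TILTED MEASURE `e^{−cS}π̄/Z_c` (weak form, `C¹` test
  functionals, `c ≥ 0`).

NOT CLAIMED: existence of exact solutions of `𝓛_sG = S + C_s` on an interval (for an autonomous `G`
this forces `Σ_n⟨∂̃_nS, ∂̃_nG⟩` to be constant on `Ω`; the criterion is the exact shadow of the
truncated statements of the sequel `Exactness/SphereLOMapTransportDefect.lean`); equality of
measures beyond the weak form; time-dependent generators; the Jacobian of `Φ_t`; anything about
autocorrelations or the rung's numbers.
-/

noncomputable section

namespace Summit.Ventures.LatticeQCDFlow.Exactness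

open Function Set Metric MeasureTheory NormedSpace InnerProductSpace
open scoped RealInnerProductSpace Topology

variable {Λ : Type*} {E : Type*} [NormedAddCommGroup E] [InnerProductSpace ℝ E]
  [FiniteDimensional ℝ E] [Fintype Λ] [DecidableEq Λ] [MeasurableSpace E] [BorelSpace E]
  [Nontrivial E]

/-! ## §1 The covariance law for the tilted means -/

section Covariance

/-- **`Z′(s₀) = −∫ e^{−s₀S}S dπ̄`** for `Z(s) = ∫e^{−sS}dπ̄`, `S ∈ C¹` (the transport identity with
`H ≡ 1` and the zero generator). -/
theorem hasDerivAt_integral_exp_neg_mul {S : (Λ → E) → ℝ} (hS : ContDiff ℝ 1 S) (s₀ : ℝ) :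
    HasDerivAt (fun s => ∫ ω, Real.exp (-(s * S (fun m => ((ω : Λ → sphere (0 : E) 1) m : E))))
        ∂Measure.pi (fun _ : Λ => uniformSphere (volume : Measure E)))
      (-∫ ω, Real.exp (-(s₀ * S (fun m => ((ω : Λ → sphere (0 : E) 1) m : E)))) *
          S (fun m => (ω m : E)) ∂Measure.pi (fun _ : Λ => uniformSphere (volume : Measure E))) s₀ := by
  have h0 : ∀ (n : Λ) (x : Λ → E), siteGrad n (fun _ : Λ → E => (0 : ℝ)) x = 0 := fun n x => by
    rw [siteGrad, gradient, fderiv_const_apply, map_zero]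
  have hL : ∀ (t : ℝ) (x : Λ → E), sphereLuscherL S t (fun _ => (0 : ℝ)) x = 0 := fun t x => by
    rw [sphereLuscherL_apply]
    have hl : ∀ n, siteLaplacian n (fun _ : Λ → E => (0 : ℝ)) x = 0 := fun n => by
      simp [siteLaplacian]
    simp [h0, hl]
  have h := hasDerivAt_integral_exp_mul_comp_family (Ψ := fun _ z => z) (Gs := fun _ _ => (0 : ℝ))
    (H := fun _ => (1 : ℝ)) hS contDiff_const contDiff_snd (fun _ => contDiff_const)
    (fun n => by simp only [h0]; exact continuous_const)
    (fun s ω => by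
      have e : fderiv ℝ (fun _ : Λ → E => (1 : ℝ)) (fun m => (ω m : E))
          (fun n => siteGrad n (fun _ : Λ → E => (0 : ℝ)) (fun m => (ω m : E))) = 0 := by
        rw [fderiv_const_apply, zero_apply]
      rw [e]
      exact hasDerivAt_const s (1 : ℝ)) s₀
  simp only [mul_one, hL, zero_sub] at h
  refine h.congr_deriv ?_
  rw [← integral_neg]
  refine integral_congr_ae (ae_of_all _ fun ω => ?_)
  ring

/-- **THE COVARIANCE LAW, ABSTRACT FAMILY.**  Under the hypotheses of the transport identity, the
tilted mean `⟨H∘Ψ_s⟩_s = ∫e^{−sS}(H∘Ψ_s)dπ̄ / ∫e^{−sS}dπ̄` has derivative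
`⟨(H∘Ψ_s)·R_s⟩_s − ⟨H∘Ψ_s⟩_s·⟨R_s⟩_s` at `s = s₀`, `R_s = 𝓛_sG_s − S`: THE COVARIANCE OF THE
TRANSPORTED OBSERVABLE WITH THE RESIDUAL OF THE FLOW EQUATION under the tilted measure. -/
theorem hasDerivAt_tiltedMean_comp_family {S H : (Λ → E) → ℝ} {Ψ : ℝ → (Λ → E) → (Λ → E)}
    {Gs : ℝ → (Λ → E) → ℝ} (hS : ContDiff ℝ 1 S) (hH : ContDiff ℝ 1 H)
    (hΨ : ContDiff ℝ 1 fun q : ℝ × (Λ → E) => Ψ q.1 q.2) (hGs : ∀ s, ContDiff ℝ 2 (Gs s))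
    (hV : ∀ n, Continuous fun p : ℝ × (Λ → sphere (0 : E) 1) =>
      siteGrad n (Gs p.1) (fun m => (p.2 m : E)))
    (hderiv : ∀ (s : ℝ) (ω : Λ → sphere (0 : E) 1),
      HasDerivAt (fun s' => H (Ψ s' (fun m => (ω m : E))))
        (fderiv ℝ (fun z => H (Ψ s z)) (fun m => (ω m : E))
          (fun n => siteGrad n (Gs s) (fun m => (ω m : E)))) s)
    (s₀ : ℝ) :
    HasDerivAt (fun s =>
        (∫ ω, Real.exp (-(s * S (fun m => ((ω : Λ → sphere (0 : E) 1) m : E)))) *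
            H (Ψ s (fun m => (ω m : E))) ∂Measure.pi (fun _ : Λ => uniformSphere (volume : Measure E))) /
          ∫ ω, Real.exp (-(s * S (fun m => ((ω : Λ → sphere (0 : E) 1) m : E))))
            ∂Measure.pi (fun _ : Λ => uniformSphere (volume : Measure E)))
      ((∫ ω, Real.exp (-(s₀ * S (fun m => ((ω : Λ → sphere (0 : E) 1) m : E)))) *
            H (Ψ s₀ (fun m => (ω m : E))) *
              (sphereLuscherL S s₀ (Gs s₀) (fun m => (ω m : E)) - S (fun m => (ω m : E)))
          ∂Measure.pi (fun _ : Λ => uniformSphere (volume : Measure E))) /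
          (∫ ω, Real.exp (-(s₀ * S (fun m => ((ω : Λ → sphere (0 : E) 1) m : E))))
            ∂Measure.pi (fun _ : Λ => uniformSphere (volume : Measure E))) -
        (∫ ω, Real.exp (-(s₀ * S (fun m => ((ω : Λ → sphere (0 : E) 1) m : E)))) *
            H (Ψ s₀ (fun m => (ω m : E))) ∂Measure.pi (fun _ : Λ => uniformSphere (volume : Measure E))) /
          (∫ ω, Real.exp (-(s₀ * S (fun m => ((ω : Λ → sphere (0 : E) 1) m : E))))
            ∂Measure.pi (fun _ : Λ => uniformSphere (volume : Measure E))) *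
        ((∫ ω, Real.exp (-(s₀ * S (fun m => ((ω : Λ → sphere (0 : E) 1) m : E)))) *
              (sphereLuscherL S s₀ (Gs s₀) (fun m => (ω m : E)) - S (fun m => (ω m : E)))
            ∂Measure.pi (fun _ : Λ => uniformSphere (volume : Measure E))) /
          ∫ ω, Real.exp (-(s₀ * S (fun m => ((ω : Λ → sphere (0 : E) 1) m : E))))
            ∂Measure.pi (fun _ : Λ => uniformSphere (volume : Measure E)))) s₀ := by
  have hZ := integral_exp_neg_mul_pos (Λ := Λ) (E := E) hS.continuous s₀
  have hnum := hasDerivAt_integral_exp_mul_comp_family hS hH hΨ hGs hV hderiv s₀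
  have hden := hasDerivAt_integral_exp_neg_mul (Λ := Λ) (E := E) hS s₀
  have h := hnum.div hden hZ.ne'
  refine h.congr_deriv ?_
  -- `∫ e^{−s₀S} R dπ̄ = −∫ e^{−s₀S} S dπ̄` because `∫ e^{−s₀S}𝓛G dπ̄ = 0`
  have hcW := continuous_exp_neg_mul_sphereConfig (Λ := Λ) hS.continuous s₀
  have hSc : Continuous fun ω : Λ → sphere (0 : E) 1 => S (fun m => (ω m : E)) :=
    hS.continuous.comp continuous_sphereConfig
  have hi1 : Integrable (fun ω : Λ → sphere (0 : E) 1 =>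
      Real.exp (-(s₀ * S (fun m => (ω m : E)))) * sphereLuscherL S s₀ (Gs s₀) (fun m => (ω m : E)))
        (Measure.pi fun _ : Λ => uniformSphere (volume : Measure E)) :=
    integrable_pi_of_continuous _ (hcW.mul (continuous_sphereLuscherL_sphereConfig hS (hGs s₀) s₀))
  have hi2 : Integrable (fun ω : Λ → sphere (0 : E) 1 =>
      Real.exp (-(s₀ * S (fun m => (ω m : E)))) * S (fun m => (ω m : E)))
        (Measure.pi fun _ : Λ => uniformSphere (volume : Measure E)) :=
    integrable_pi_of_continuous _ (hcW.mul hSc)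
  have hR : ∫ ω, Real.exp (-(s₀ * S (fun m => ((ω : Λ → sphere (0 : E) 1) m : E)))) *
        (sphereLuscherL S s₀ (Gs s₀) (fun m => (ω m : E)) - S (fun m => (ω m : E)))
          ∂Measure.pi (fun _ : Λ => uniformSphere (volume : Measure E)) =
      -∫ ω, Real.exp (-(s₀ * S (fun m => ((ω : Λ → sphere (0 : E) 1) m : E)))) *
          S (fun m => (ω m : E)) ∂Measure.pi (fun _ : Λ => uniformSphere (volume : Measure E)) := by
    simp_rw [mul_sub]
    rw [integral_sub hi1 hi2, integral_exp_mul_sphereLuscherL_eq_zero hS (hGs s₀) s₀, zero_sub]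
  rw [hR]
  field_simp

variable {G : (Λ → E) → ℝ}

/-- **THE COVARIANCE LAW FOR THE SPHERE GRADIENT FLOW**:
`(d/ds)|_{s₀} ⟨H∘Φ_{c−s}⟩_s = ⟨(H∘Φ_{c−s₀})·R⟩_{s₀} − ⟨H∘Φ_{c−s₀}⟩_{s₀}·⟨R⟩_{s₀}`, `R = 𝓛_{s₀}G − S`,
`⟨·⟩_s = ∫e^{−sS}·dπ̄/∫e^{−sS}dπ̄` (`S, H ∈ C¹`, `G ∈ C²`, all real `c`, `s₀`). -/
theorem hasDerivAt_tiltedMean_comp_sphereGradientFlow {S H : (Λ → E) → ℝ} (hS : ContDiff ℝ 1 S)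
    (hG : ContDiff ℝ 2 G) (hH : ContDiff ℝ 1 H) (c s₀ : ℝ) :
    HasDerivAt (fun s =>
        (∫ ω, Real.exp (-(s * S (fun m => ((ω : Λ → sphere (0 : E) 1) m : E)))) *
            H (sphereGradientFlow hG (fun m => (ω m : E)) (c - s))
              ∂Measure.pi (fun _ : Λ => uniformSphere (volume : Measure E))) /
          ∫ ω, Real.exp (-(s * S (fun m => ((ω : Λ → sphere (0 : E) 1) m : E))))
            ∂Measure.pi (fun _ : Λ => uniformSphere (volume : Measure E)))
      ((∫ ω, Real.exp (-(s₀ * S (fun m => ((ω : Λ → sphere (0 : E) 1) m : E)))) *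
            H (sphereGradientFlow hG (fun m => (ω m : E)) (c - s₀)) *
              (sphereLuscherL S s₀ G (fun m => (ω m : E)) - S (fun m => (ω m : E)))
          ∂Measure.pi (fun _ : Λ => uniformSphere (volume : Measure E))) /
          (∫ ω, Real.exp (-(s₀ * S (fun m => ((ω : Λ → sphere (0 : E) 1) m : E))))
            ∂Measure.pi (fun _ : Λ => uniformSphere (volume : Measure E))) -
        (∫ ω, Real.exp (-(s₀ * S (fun m => ((ω : Λ → sphere (0 : E) 1) m : E)))) *
            H (sphereGradientFlow hG (fun m => (ω m : E)) (c - s₀))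
              ∂Measure.pi (fun _ : Λ => uniformSphere (volume : Measure E))) /
          (∫ ω, Real.exp (-(s₀ * S (fun m => ((ω : Λ → sphere (0 : E) 1) m : E))))
            ∂Measure.pi (fun _ : Λ => uniformSphere (volume : Measure E))) *
        ((∫ ω, Real.exp (-(s₀ * S (fun m => ((ω : Λ → sphere (0 : E) 1) m : E)))) *
              (sphereLuscherL S s₀ G (fun m => (ω m : E)) - S (fun m => (ω m : E)))
            ∂Measure.pi (fun _ : Λ => uniformSphere (volume : Measure E))) /
          ∫ ω, Real.exp (-(s₀ * S (fun m => ((ω : Λ → sphere (0 : E) 1) m : E))))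
            ∂Measure.pi (fun _ : Λ => uniformSphere (volume : Measure E)))) s₀ :=
  hasDerivAt_tiltedMean_comp_family (Ψ := fun s z => sphereGradientFlow hG z (c - s))
    (Gs := fun _ => G) hS hH
    ((contDiff_sphereGradientFlow hG).comp (contDiff_snd.prodMk (contDiff_const.sub contDiff_fst)))
    (fun _ => hG) (fun n => (continuous_siteGrad_sphereConfig (hG.of_le (by norm_num)) n).comp
      continuous_snd)
    (fun s ω => hasDerivAt_comp_sphereGradientFlow_sub hG (hH.differentiable one_ne_zero)
      (norm_sphereConfig_eq_one ω) c s) s₀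

end Covariance

/-! ## §2 Lüscher's criterion: a solution of the flow equation trivializes the tilted measure -/

section Luscher

/-- **A CONSTANT RESIDUAL FREEZES THE TILTED MEAN, ABSTRACT FAMILY.**  If, on top of the
hypotheses of the transport identity, the residual `𝓛_sG_s − S` is CONSTANT on `Ω` for every
`s ∈ [a, b]` (Lüscher's flow equation `𝓛_sG_s = S + C_s`), then `s ↦ ⟨H∘Ψ_s⟩_s` is constant on
`[a, b]`. -/
theorem tiltedMean_comp_family_eq_of_residual_const {S H : (Λ → E) → ℝ}
    {Ψ : ℝ → (Λ → E) → (Λ → E)} {Gs : ℝ → (Λ → E) → ℝ} (hS : ContDiff ℝ 1 S) (hH : ContDiff ℝ 1 H)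
    (hΨ : ContDiff ℝ 1 fun q : ℝ × (Λ → E) => Ψ q.1 q.2) (hGs : ∀ s, ContDiff ℝ 2 (Gs s))
    (hV : ∀ n, Continuous fun p : ℝ × (Λ → sphere (0 : E) 1) =>
      siteGrad n (Gs p.1) (fun m => (p.2 m : E)))
    (hderiv : ∀ (s : ℝ) (ω : Λ → sphere (0 : E) 1),
      HasDerivAt (fun s' => H (Ψ s' (fun m => (ω m : E))))
        (fderiv ℝ (fun z => H (Ψ s z)) (fun m => (ω m : E))
          (fun n => siteGrad n (Gs s) (fun m => (ω m : E)))) s)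
    {a b : ℝ} {C : ℝ → ℝ}
    (hsol : ∀ s ∈ Icc a b, ∀ ω : Λ → sphere (0 : E) 1,
      sphereLuscherL S s (Gs s) (fun m => (ω m : E)) = S (fun m => (ω m : E)) + C s)
    {s : ℝ} (hs : s ∈ Icc a b) :
    (∫ ω, Real.exp (-(s * S (fun m => ((ω : Λ → sphere (0 : E) 1) m : E)))) *
          H (Ψ s (fun m => (ω m : E))) ∂Measure.pi (fun _ : Λ => uniformSphere (volume : Measure E))) /
        ∫ ω, Real.exp (-(s * S (fun m => ((ω : Λ → sphere (0 : E) 1) m : E))))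
          ∂Measure.pi (fun _ : Λ => uniformSphere (volume : Measure E)) =
      (∫ ω, Real.exp (-(a * S (fun m => ((ω : Λ → sphere (0 : E) 1) m : E)))) *
          H (Ψ a (fun m => (ω m : E))) ∂Measure.pi (fun _ : Λ => uniformSphere (volume : Measure E))) /
        ∫ ω, Real.exp (-(a * S (fun m => ((ω : Λ → sphere (0 : E) 1) m : E))))
          ∂Measure.pi (fun _ : Λ => uniformSphere (volume : Measure E)) := by
  have hg := fun s₀ => hasDerivAt_tiltedMean_comp_family hS hH hΨ hGs hV hderiv s₀
  refine constant_of_has_deriv_right_zero (fun s₀ _ => (hg s₀).continuousAt.continuousWithinAt)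
    (fun s₀ hs₀ => ?_) s hs
  have hs₀' : s₀ ∈ Icc a b := Ico_subset_Icc_self hs₀
  refine ((hg s₀).hasDerivWithinAt).congr_deriv ?_
  have hZ := integral_exp_neg_mul_pos (Λ := Λ) (E := E) hS.continuous s₀
  -- the residual is the constant `C s₀`
  have hRω : ∀ ω : Λ → sphere (0 : E) 1,
      sphereLuscherL S s₀ (Gs s₀) (fun m => (ω m : E)) - S (fun m => (ω m : E)) = C s₀ := fun ω => by
    rw [hsol s₀ hs₀' ω]; ring
  simp_rw [hRω]
  rw [integral_mul_const, integral_mul_const]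
  field_simp
  ring

variable {G : (Λ → E) → ℝ}

/-- **LÜSCHER'S CRITERION ON THE LATTICE OF SITE SPHERES (autonomous generator).**  Let `S ∈ C¹`,
`G ∈ C²` with sphere gradient flow `Φ` (`ẋ_n = −∂̃_nG(x)`), `0 ≤ c`.  If `G` solves Lüscher's flow
equation `𝓛_sG = S + C_s` on `Ω` for every `s ∈ [0, c]`, then for every `C¹` observable `H`
`∫ H(Φ_c ω) dπ̄(ω) = ∫ e^{−cS}H dπ̄ / ∫ e^{−cS} dπ̄`: THE FLOW MAP `Φ_c` TRANSPORTS THE A-PRIORI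
MEASURE `π̄` TO THE TILTED MEASURE `e^{−cS}π̄/Z_c` — proved by transporting the observable
(no Jacobians). -/
theorem integral_comp_sphereGradientFlow_eq_tiltedMean {S H : (Λ → E) → ℝ} (hS : ContDiff ℝ 1 S)
    (hG : ContDiff ℝ 2 G) (hH : ContDiff ℝ 1 H) {c : ℝ} (hc : 0 ≤ c) {C : ℝ → ℝ}
    (hsol : ∀ s ∈ Icc 0 c, ∀ ω : Λ → sphere (0 : E) 1,
      sphereLuscherL S s G (fun m => (ω m : E)) = S (fun m => (ω m : E)) + C s) :
    ∫ ω, H (sphereGradientFlow hG (fun m => ((ω : Λ → sphere (0 : E) 1) m : E)) c)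
        ∂Measure.pi (fun _ : Λ => uniformSphere (volume : Measure E)) =
      (∫ ω, Real.exp (-(c * S (fun m => ((ω : Λ → sphere (0 : E) 1) m : E)))) * H (fun m => (ω m : E))
          ∂Measure.pi (fun _ : Λ => uniformSphere (volume : Measure E))) /
        ∫ ω, Real.exp (-(c * S (fun m => ((ω : Λ → sphere (0 : E) 1) m : E))))
          ∂Measure.pi (fun _ : Λ => uniformSphere (volume : Measure E)) := by
  have h := tiltedMean_comp_family_eq_of_residual_const (Ψ := fun s z => sphereGradientFlow hG z (c - s))
    (Gs := fun _ => G) hS hH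
    ((contDiff_sphereGradientFlow hG).comp (contDiff_snd.prodMk (contDiff_const.sub contDiff_fst)))
    (fun _ => hG) (fun n => (continuous_siteGrad_sphereConfig (hG.of_le (by norm_num)) n).comp
      continuous_snd)
    (fun s ω => hasDerivAt_comp_sphereGradientFlow_sub hG (hH.differentiable one_ne_zero)
      (norm_sphereConfig_eq_one ω) c s) hsol (s := c) ⟨hc, le_rfl⟩
  simp only [sub_self, sphereGradientFlow_zero, sub_zero, zero_mul, neg_zero, Real.exp_zero, one_mul,
    integral_const, smul_eq_mul, mul_one, probReal_univ, div_one] at h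
  -- `h : ⟨H⟩_c = ∫ H∘Φ_c dπ̄`
  exact h.symm

/-- The same in Mathlib's tilted-measure vocabulary: under Lüscher's criterion,
`∫ H∘Φ_c dπ̄ = ∫ H d(π̄.tilted(−cS))` for every `C¹` observable (`μ_c = e^{−cS}π̄/Z_c`). -/
theorem integral_comp_sphereGradientFlow_eq_integral_tilted {S H : (Λ → E) → ℝ}
    (hS : ContDiff ℝ 1 S) (hG : ContDiff ℝ 2 G) (hH : ContDiff ℝ 1 H) {c : ℝ} (hc : 0 ≤ c)
    {C : ℝ → ℝ}
    (hsol : ∀ s ∈ Icc 0 c, ∀ ω : Λ → sphere (0 : E) 1,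
      sphereLuscherL S s G (fun m => (ω m : E)) = S (fun m => (ω m : E)) + C s) :
    ∫ ω, H (sphereGradientFlow hG (fun m => ((ω : Λ → sphere (0 : E) 1) m : E)) c)
        ∂Measure.pi (fun _ : Λ => uniformSphere (volume : Measure E)) =
      ∫ ω, H (fun m => ((ω : Λ → sphere (0 : E) 1) m : E))
        ∂(Measure.pi (fun _ : Λ => uniformSphere (volume : Measure E))).tilted
          (fun ω => -(c * S (fun m => (ω m : E)))) := by
  rw [integral_tilted_neg_action, integral_comp_sphereGradientFlow_eq_tiltedMean hS hG hH hc hsol]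

end Luscher

end Summit.Ventures.LatticeQCDFlow.Exactness

end
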